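import Mathlib

/-!
# Static tridiagonal monomial pencils: the DIAGONAL GAUGE normal form `X · F(x) · X = D(x) + A`

HONEST FRAMING.  Helper lemma (seat val-sym-lift-p1 g10, cell `pub-symmetroid`, 2026-08-27; asked for by the desk, R2118 (1)) for
the TYPED α TARGET of record (R2102 → R2114): «a real symmetric TRIDIAGONAL matrix of MONOMIALS `c i j · x ^ (e i j)` with positive
diagonal coefficients has at most `C·m + C₀` distinct positive determinant zeros».  Nothing here bears on that bound, on
`stub_tridiagonalSectorB` / `WeakLifting` (stmt-ValiantsHypothesis-19561) in its window, `TropicalB`, Conjecture B, the Door-A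
registers, `MatrixDescartes` (stmt-ValiantsHypothesis-18050) or VP ≠ VNP.  It is a change of variables, so that rows proved in either
currency transfer verbatim.

THE GAUGE.  Let `F(x)_{ij} = c_{ij} x^{e_{ij}}` be tridiagonal (`c_{ij} = 0` for `|i − j| ≥ 2`).  The path `1 — 2 — ⋯ — m` is a tree, so
the integer system `t_i + t_j = −e_{ij}` (one equation per band pair `|i − j| = 1`, with `e` symmetric there) is solvable
(`exists_gaugeExp`: `t_i = (−1)^{i+1} Σ_{k<i} (−1)^{k+1} e_{k,k+1}`).  With `X = diag(x^{t_i})` and `x ≠ 0`: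

  `X · F(x) · X = diag(c_{ii} x^{e_{ii} + 2 t_i}) + A`,  `A_{ij} = c_{ij}` for `|i − j| = 1` and `0` otherwise

(`gauge_conj`; integer powers `zpow`, the exponents `e_{ii} + 2 t_i` may be negative) — the off-diagonal part becomes a CONSTANT
matrix and all the `x`-dependence sits in a positive (when `c_{ii} > 0`, `x > 0`) monomial DIAGONAL.  Consequently
`(x^{Σ t_i})² · det F(x) = det(D(x) + A)` (`det_gauge`), for `x ≠ 0` the determinant of the polynomial matrix vanishes at `x` iff
`det(D(x) + A) = 0` (`isRoot_det_iff`), and a bound on the number of positive zeros of `x ↦ det(D(x)+A)` is a bound on the number of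
distinct positive determinant zeros in the target's `roots.toFinset.filter (0 < ·)` currency (`card_posRoots_le_of_gauge`), and
conversely (`card_le_card_posRoots_of_gauge`).  No symmetry of `c` and no sign condition is used by the identity itself.
No definition is introduced (the gauge exponents enter as a hypothesis `ht`, discharged by `exists_gaugeExp`). [folklore]
-/

set_option linter.dupNamespace false
set_option autoImplicit false

namespace Summit.ValiantsHypothesis.ValiantsHypothesis.Theorems.KPlusLogSqLaw.StaticTridiagonalGauge

open Matrix Polynomial Finset

variable {m : ℕ}

/-- **Gauge exponents exist along the path**: for exponents `e` symmetric on the band pairs there are integers `t_i` with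
`t_i + t_j = −e_{ij}` whenever `|i − j| = 1` (explicitly `t_i = (−1)^{i+1} Σ_{k<i} (−1)^{k+1} e_{k,k+1}`). [folklore] -/
theorem exists_gaugeExp (e : Fin m → Fin m → ℕ)
    (he : ∀ i j : Fin m, (i : ℕ) + 1 = j → e i j = e j i) :
    ∃ t : Fin m → ℤ, ∀ i j : Fin m, ((i : ℕ) + 1 = j ∨ (j : ℕ) + 1 = i) → t i + t j = -(e i j : ℤ) := by
  classical
  -- the band exponents as a function on ℕ, and the alternating recursion `T (k+1) = -E k - T k`, `T 0 = 0`
  let E : ℕ → ℤ := fun k => if h : k + 1 < m then (e ⟨k, by omega⟩ ⟨k + 1, h⟩ : ℤ) else 0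
  let T : ℕ → ℤ := fun n => Nat.rec (motive := fun _ => ℤ) 0 (fun k acc => -E k - acc) n
  have hT : ∀ n, T n + T (n + 1) = -E n := by
    intro n
    show T n + (-E n - T n) = -E n
    ring
  refine ⟨fun i => T i, ?_⟩
  intro i j hij
  show T (i : ℕ) + T (j : ℕ) = -(e i j : ℤ)
  rcases hij with h | h
  · have hj : (j : ℕ) = i + 1 := h.symm
    have hE : E i = (e i j : ℤ) := by
      have hlt : (i : ℕ) + 1 < m := by omega
      simp only [E, dif_pos hlt]
      congr 2
      exact Fin.ext (by simp [hj])
    rw [hj, hT, hE]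
  · have hi : (i : ℕ) = j + 1 := h.symm
    have hE : E j = (e i j : ℤ) := by
      have hlt : (j : ℕ) + 1 < m := by omega
      simp only [E, dif_pos hlt]
      rw [he ⟨j, by omega⟩ ⟨j + 1, hlt⟩ rfl]
      congr 2
      exact Fin.ext (by simp [hi])
    rw [add_comm, hi, hT, hE]

/-- **The gauge identity** `diag(x^{t}) · F(x) · diag(x^{t}) = diag(c_{ii} x^{e_{ii}+2t_i}) + A` for a tridiagonal monomial matrix
`F(x) = (c_{ij} x^{e_{ij}})` evaluated at `x ≠ 0`, gauge exponents `t` with `t_i + t_j = −e_{ij}` on the band, and `A` the CONSTANT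
matrix of the off-diagonal coefficients. [folklore] -/
theorem gauge_conj (c : Fin m → Fin m → ℝ) (e : Fin m → Fin m → ℕ)
    (hband : ∀ i j : Fin m, (i : ℕ) + 1 < j ∨ (j : ℕ) + 1 < i → c i j = 0)
    (t : Fin m → ℤ) (ht : ∀ i j : Fin m, ((i : ℕ) + 1 = j ∨ (j : ℕ) + 1 = i) → t i + t j = -(e i j : ℤ))
    {x : ℝ} (hx : x ≠ 0) :
    Matrix.diagonal (fun i => x ^ t i) * (Matrix.of fun i j => C (c i j) * (X : ℝ[X]) ^ e i j).map (eval x) *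
        Matrix.diagonal (fun i => x ^ t i) =
      Matrix.diagonal (fun i => c i i * x ^ ((e i i : ℤ) + 2 * t i)) +
        Matrix.of (fun i j : Fin m => if (i : ℕ) + 1 = j ∨ (j : ℕ) + 1 = i then c i j else 0) := by
  ext i j
  rw [Matrix.mul_diagonal, Matrix.diagonal_mul, Matrix.map_apply, Matrix.of_apply, Matrix.add_apply, Matrix.of_apply]
  simp only [eval_mul, eval_C, eval_pow, eval_X]
  by_cases hij : i = j
  · subst hij
    rw [Matrix.diagonal_apply_eq, if_neg (by omega), add_zero, ← zpow_natCast,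
      show x ^ t i * (c i i * x ^ ((e i i : ℕ) : ℤ)) * x ^ t i = c i i * (x ^ t i * x ^ ((e i i : ℕ) : ℤ) * x ^ t i) by ring,
      ← zpow_add₀ hx, ← zpow_add₀ hx]
    congr 1
    ring
  · rw [Matrix.diagonal_apply_ne _ hij, zero_add]
    by_cases hb : (i : ℕ) + 1 = j ∨ (j : ℕ) + 1 = i
    · rw [if_pos hb, ← zpow_natCast,
        show x ^ t i * (c i j * x ^ ((e i j : ℕ) : ℤ)) * x ^ t j = c i j * (x ^ t i * x ^ t j * x ^ ((e i j : ℕ) : ℤ)) by ring,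
        ← zpow_add₀ hx, ← zpow_add₀ hx, ht i j hb]
      simp
    · rw [if_neg hb]
      have hfar : (i : ℕ) + 1 < j ∨ (j : ℕ) + 1 < i := by
        have : (i : ℕ) ≠ j := fun h => hij (Fin.ext h)
        omega
      rw [hband i j hfar]
      ring

/-- **Determinant form of the gauge**: `(x^{Σ t_i})² · det F(x) = det(diag(c_{ii} x^{e_{ii}+2t_i}) + A)` for `x ≠ 0`. [folklore] -/
theorem det_gauge (c : Fin m → Fin m → ℝ) (e : Fin m → Fin m → ℕ)
    (hband : ∀ i j : Fin m, (i : ℕ) + 1 < j ∨ (j : ℕ) + 1 < i → c i j = 0)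
    (t : Fin m → ℤ) (ht : ∀ i j : Fin m, ((i : ℕ) + 1 = j ∨ (j : ℕ) + 1 = i) → t i + t j = -(e i j : ℤ))
    {x : ℝ} (hx : x ≠ 0) :
    (∏ i, x ^ t i) ^ 2 * (Matrix.det (Matrix.of fun i j => C (c i j) * (X : ℝ[X]) ^ e i j)).eval x =
      Matrix.det (Matrix.diagonal (fun i => c i i * x ^ ((e i i : ℤ) + 2 * t i)) +
        Matrix.of (fun i j : Fin m => if (i : ℕ) + 1 = j ∨ (j : ℕ) + 1 = i then c i j else 0)) := by
  rw [← gauge_conj c e hband t ht hx, Matrix.det_mul, Matrix.det_mul, Matrix.det_diagonal]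
  have hev : (Matrix.det (Matrix.of fun i j => C (c i j) * (X : ℝ[X]) ^ e i j)).eval x =
      Matrix.det ((Matrix.of fun i j => C (c i j) * (X : ℝ[X]) ^ e i j).map (eval x)) := by
    rw [← Polynomial.coe_evalRingHom, RingHom.map_det, RingHom.mapMatrix_apply]
  rw [hev]
  ring

/-- **Zeros transfer**: for `x ≠ 0`, `det F` (a real polynomial) vanishes at `x` iff `det(D(x) + A) = 0`. [folklore] -/
theorem isRoot_det_iff (c : Fin m → Fin m → ℝ) (e : Fin m → Fin m → ℕ)
    (hband : ∀ i j : Fin m, (i : ℕ) + 1 < j ∨ (j : ℕ) + 1 < i → c i j = 0)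
    (t : Fin m → ℤ) (ht : ∀ i j : Fin m, ((i : ℕ) + 1 = j ∨ (j : ℕ) + 1 = i) → t i + t j = -(e i j : ℤ))
    {x : ℝ} (hx : x ≠ 0) :
    (Matrix.det (Matrix.of fun i j => C (c i j) * (X : ℝ[X]) ^ e i j)).IsRoot x ↔
      Matrix.det (Matrix.diagonal (fun i => c i i * x ^ ((e i i : ℤ) + 2 * t i)) +
        Matrix.of (fun i j : Fin m => if (i : ℕ) + 1 = j ∨ (j : ℕ) + 1 = i then c i j else 0)) = 0 := by
  rw [Polynomial.IsRoot.def, ← det_gauge c e hband t ht hx]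
  have hp : (∏ i, x ^ t i) ^ 2 ≠ 0 := pow_ne_zero _ (Finset.prod_ne_zero_iff.mpr fun i _ => zpow_ne_zero _ hx)
  constructor
  · intro h; rw [h, mul_zero]
  · intro h
    rcases mul_eq_zero.mp h with h1 | h1
    · exact absurd h1 hp
    · exact h1

/-- **Upper bounds transfer to the α target's currency**: if the gauged determinant `x ↦ det(D(x) + A)` has at most `B` positive zeros
(every finite set of positive zeros has at most `B` elements), then the polynomial determinant has at most `B` distinct positive
roots in the `roots.toFinset.filter (0 < ·)` count. [folklore] -/
theorem card_posRoots_le_of_gauge (c : Fin m → Fin m → ℝ) (e : Fin m → Fin m → ℕ)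
    (hband : ∀ i j : Fin m, (i : ℕ) + 1 < j ∨ (j : ℕ) + 1 < i → c i j = 0)
    (t : Fin m → ℤ) (ht : ∀ i j : Fin m, ((i : ℕ) + 1 = j ∨ (j : ℕ) + 1 = i) → t i + t j = -(e i j : ℤ))
    (B : ℕ)
    (hB : ∀ S : Finset ℝ, (∀ x ∈ S, 0 < x ∧
        Matrix.det (Matrix.diagonal (fun i => c i i * x ^ ((e i i : ℤ) + 2 * t i)) +
          Matrix.of (fun i j : Fin m => if (i : ℕ) + 1 = j ∨ (j : ℕ) + 1 = i then c i j else 0)) = 0) → S.card ≤ B) :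
    ((Matrix.det (Matrix.of fun i j => C (c i j) * (X : ℝ[X]) ^ e i j)).roots.toFinset.filter
        (fun x : ℝ => 0 < x)).card ≤ B := by
  refine hB _ fun x hx => ?_
  rw [Finset.mem_filter, Multiset.mem_toFinset] at hx
  refine ⟨hx.2, ?_⟩
  have hr := (Polynomial.mem_roots'.mp hx.1).2
  exact (isRoot_det_iff c e hband t ht (ne_of_gt hx.2)).mp hr

/-- **Lower bounds transfer as well**: when the polynomial determinant is not the zero polynomial, any finite set of positive zeros of
the gauged determinant is counted by the target's `roots.toFinset.filter (0 < ·)`. [folklore] -/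
theorem card_le_card_posRoots_of_gauge (c : Fin m → Fin m → ℝ) (e : Fin m → Fin m → ℕ)
    (hband : ∀ i j : Fin m, (i : ℕ) + 1 < j ∨ (j : ℕ) + 1 < i → c i j = 0)
    (t : Fin m → ℤ) (ht : ∀ i j : Fin m, ((i : ℕ) + 1 = j ∨ (j : ℕ) + 1 = i) → t i + t j = -(e i j : ℤ))
    (hF : Matrix.det (Matrix.of fun i j => C (c i j) * (X : ℝ[X]) ^ e i j) ≠ 0)
    (S : Finset ℝ) (hS : ∀ x ∈ S, 0 < x ∧
        Matrix.det (Matrix.diagonal (fun i => c i i * x ^ ((e i i : ℤ) + 2 * t i)) +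
          Matrix.of (fun i j : Fin m => if (i : ℕ) + 1 = j ∨ (j : ℕ) + 1 = i then c i j else 0)) = 0) :
    S.card ≤ ((Matrix.det (Matrix.of fun i j => C (c i j) * (X : ℝ[X]) ^ e i j)).roots.toFinset.filter
        (fun x : ℝ => 0 < x)).card := by
  refine Finset.card_le_card fun x hx => ?_
  obtain ⟨hx0, hx1⟩ := hS x hx
  rw [Finset.mem_filter, Multiset.mem_toFinset, Polynomial.mem_roots hF]
  exact ⟨(isRoot_det_iff c e hband t ht (ne_of_gt hx0)).mpr hx1, hx0⟩

end Summit.ValiantsHypothesis.ValiantsHypothesis.Theorems.KPlusLogSqLaw.StaticTridiagonalGauge
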